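import Mathlib
import Literature.Computability.AlgebraicComplexity.MS08Obstructions
import Literature.Computability.AlgebraicComplexity.OrbitCoordinateRingProofs
import Literature.Computability.Complexity.OccurrenceObstructionsBIP
import Literature.NumberTheory.DiophantineGeometry.SchurWeylPlethysmKroneckerBoundProofs

/-!
# K2 `PowGenDegreeQP` (stmt-ValiantsHypothesis-11655), line `trace-side-regimes`:
# a Borel-dense orbit point makes the covariant algebra multiplicity-free and its generator
# types the atoms of the occurrence monoid

Helper file (`--supports stmt-ValiantsHypothesis-11655`) for the registered stubs `stub_sliceGen` /
`stub_wideGen` of `Cruxes/GenFlipThesis/Lines/trace_side_regimes.lean`.  It supplies the METHOD by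
which whole rows `m = const` of the quasi-polynomial window of K2 are computed exactly (row `m = 1`
in the sibling file `…PowGenDegreeQPRowOne.lean`; row `m = 2`, quadrics, needs in addition only the
Cholesky density of the Borel orbit of `∑ xᵢ²`).

Let `f` be a form of degree `m` on the linearly ordered letters `σ`, `A(f) = ⊕_χ HWV_χ(k[Δ_m f])`
its covariant algebra (highest-weight vectors = `B`-semi-invariants of the coordinate ring of the
orbit closure, `highestWeightSpace (orbitCoordRep f m) χ`), and `γ_χ(f)` the number of minimal
generators of type `χ` (dimension of `HWV_χ` modulo the products `HWV_χ₁ · HWV_χ₂`, `χ₁ + χ₂ = χ`,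
`χᵢ ≠ 0`).  Write `x(g · f) = evalAtPoint f m (orbitCoordRep f m g⁻¹ x)` for the value of a class
`x ∈ k[Δ_m f]` at the orbit point `g · f` (`evalAtPoint_orbitCoordRep_inv_mk`).

**Borel-dense point.**  Suppose the `B`-translates of the orbit point `h₀ · f` are Zariski dense in
`Δ_m f`, in the concrete form: a class vanishing at every `(b h₀) · f`, `b` upper triangular, is
zero (`hdense`).  Then (Vinberg–Kimel'fel'd 1978, easy direction; Popov; "a quasi-affine variety
with a dense `B`-orbit has multiplicity-free coordinate ring"):

* `eq_zero_of_mem_highestWeightSpace_of_eval_eq_zero` — a highest-weight vector vanishing at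
  `h₀ · f` is zero (`x((b h₀) · f) = χ(b)⁻¹ x(h₀ · f)`);
* `exists_smul_eq_of_mem_highestWeightSpace`, `finrank_highestWeightSpace_le_one_of_dense` —
  every `HWV_χ` has dimension `≤ 1` (MULTIPLICITY-FREE);
* `weightChar_eq_one_of_fix_of_dense` — an upper triangular `b` FIXING the point `h₀ · f` has
  `χ(b) = 1` for every occurring weight `χ` (the weight monoid lies in the annihilator of the
  stabiliser `B ∩ Stab(h₀ · f)`);
* `comap_decomposable_eq_top_of_dense`, `finrank_quotient_eq_zero_of_split_of_dense`,
  `atom_of_genType_of_dense` — if an occurring `χ` splits as `χ₁ + χ₂` into two nonzero OCCURRING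
  weights then `γ_χ(f) = 0` (the product of the two nonzero highest-weight vectors is nonzero —
  `k[Δ_m f]` is a domain — and spans the line `HWV_χ`): GENERATOR TYPES ARE EXACTLY THE ATOMS of
  the occurrence monoid `S(f)` (the converse, atoms are generator types, is general and landed:
  `…PowGenDegreeQPWideAtoms.finrank_quotient_ne_zero_of_atom`).

Scope (honest label): `Δ(per_m)` and `Δ_m(tr X_n^m)` for `m ≥ 3` are NOT Borel-dense (their
multiplicities exceed 1); the method computes the degenerate rows `m ≤ 2` of the window of K2 and
any other spherical orbit closure met by the route (Chow rays excluded).  No statement here is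
specific to the power trace.

References: E. B. Vinberg, B. N. Kimel'fel'd, Funct. Anal. Appl. 12 (1978) 168–174, Thm. 1;
V. L. Popov, *Contractions of actions of reductive algebraic groups*, Math. USSR-Sb. 58 (1987) §1;
BLMW 2011 §5.2 (left/right translations of matrix coefficients).
-/

namespace Summit.ValiantsHypothesis.ValiantsHypothesis.Theorems.GeneratorObstructions.PowGenDegreeQP

open MvPolynomial
open Literature.NumberTheory.DiophantineGeometry Literature.Computability.AlgebraicComplexity

-- `Summit.ValiantsHypothesis.ValiantsHypothesis.…` is the tree's mandated single-conjunct layout.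
set_option linter.dupNamespace false

noncomputable section

variable {σ k : Type*} [Fintype σ] [LinearOrder σ] [Field k]

/-! ## 1. Values of classes at orbit points -/

/-- The value of the class of `F` at the orbit point `g · f` is `F(g · f)`:
`evalAtPoint f m (g⁻¹ · [F]) = F((g · f)^)` (tree convention `(g · F)(v) = F(g⁻¹ · v)`).
[folklore] -/
theorem evalAtPoint_orbitCoordRep_inv_mk (f : MvPolynomial σ k) (m : ℕ) (g : GL σ k)
    (F : MvPolynomial (DegIdx σ m) k) :
    evalAtPoint f m (orbitCoordRep f m g⁻¹ (Ideal.Quotient.mk (orbitVanishingIdeal f m) F)) =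
      aeval (formCoeff m (linSubstRep σ k g f)) F := by
  rw [orbitCoordRep_apply, orbitCoordSubst_mk, evalAtPoint_mk, aeval_formCoeff_coordSubst, inv_inv]

/-- A class of `k[Δ_m f]` vanishes iff it vanishes at every orbit point `g · f`. [folklore] -/
theorem eq_zero_iff_forall_evalAtPoint_eq_zero (f : MvPolynomial σ k) (m : ℕ)
    (x : OrbitCoordRing f m) :
    x = 0 ↔ ∀ g : GL σ k, evalAtPoint f m (orbitCoordRep f m g⁻¹ x) = 0 := by
  constructor
  · rintro rfl g
    rw [map_zero, map_zero]
  · intro h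
    obtain ⟨F, rfl⟩ := Ideal.Quotient.mk_surjective x
    rw [Ideal.Quotient.eq_zero_iff_mem, mem_orbitVanishingIdeal_iff]
    intro g
    rw [← evalAtPoint_orbitCoordRep_inv_mk]
    exact h g

/-- Two orbit points `g · f = g' · f` give the same value. [folklore] -/
theorem evalAtPoint_orbitCoordRep_inv_congr (f : MvPolynomial σ k) (m : ℕ) {g g' : GL σ k}
    (hgg' : linSubstRep σ k g f = linSubstRep σ k g' f) (x : OrbitCoordRing f m) :
    evalAtPoint f m (orbitCoordRep f m g⁻¹ x) = evalAtPoint f m (orbitCoordRep f m g'⁻¹ x) := by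
  obtain ⟨F, rfl⟩ := Ideal.Quotient.mk_surjective x
  rw [evalAtPoint_orbitCoordRep_inv_mk, evalAtPoint_orbitCoordRep_inv_mk, hgg']

/-- **Left semi-invariance of the values of a highest-weight vector**: for `x ∈ HWV_χ`, `b` upper
triangular and any `g`, `x((b g) · f) = χ(b)⁻¹ · x(g · f)`. BLMW 2011 §5.2. [folklore] -/
theorem evalAtPoint_orbitCoordRep_mul_inv_of_mem_highestWeightSpace {f : MvPolynomial σ k} {m : ℕ}
    {χ : Weight σ} {x : OrbitCoordRing f m} (hx : x ∈ highestWeightSpace (orbitCoordRep f m) χ)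
    {b : GL σ k} (hb : IsUpperTriangular b) (g : GL σ k) :
    evalAtPoint f m (orbitCoordRep f m (b * g)⁻¹ x) =
      (weightChar χ b)⁻¹ * evalAtPoint f m (orbitCoordRep f m g⁻¹ x) := by
  have hb' : IsUpperTriangular b⁻¹ := (borelSubgroup σ k).inv_mem hb
  rw [mul_inv_rev, map_mul, Module.End.mul_apply, hx b⁻¹ hb', map_smul, map_smul, smul_eq_mul,
    weightChar_inv χ hb]

/-! ## 2. A Borel-dense orbit point: multiplicity-freeness -/

section Dense

variable {f : MvPolynomial σ k} {m : ℕ} {h₀ : GL σ k}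

/-- **A highest-weight vector vanishing at a Borel-dense point is zero.** If the classes vanishing
at all `(b h₀) · f` (`b` upper triangular) are zero, then any `x ∈ HWV_χ` with `x(h₀ · f) = 0`
vanishes: `x((b h₀) · f) = χ(b)⁻¹ x(h₀ · f) = 0`. Vinberg–Kimel'fel'd 1978 (proof of Thm. 1).
[folklore] -/
theorem eq_zero_of_mem_highestWeightSpace_of_eval_eq_zero
    (hdense : ∀ x : OrbitCoordRing f m,
      (∀ b : GL σ k, IsUpperTriangular b → evalAtPoint f m (orbitCoordRep f m (b * h₀)⁻¹ x) = 0) →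
        x = 0)
    {χ : Weight σ} {x : OrbitCoordRing f m} (hx : x ∈ highestWeightSpace (orbitCoordRep f m) χ)
    (h0 : evalAtPoint f m (orbitCoordRep f m h₀⁻¹ x) = 0) : x = 0 :=
  hdense x fun b hb => by
    rw [evalAtPoint_orbitCoordRep_mul_inv_of_mem_highestWeightSpace hx hb, h0, mul_zero]

/-- **A nonzero highest-weight vector does not vanish at a Borel-dense point.** [folklore] -/
theorem evalAtPoint_ne_zero_of_mem_highestWeightSpace_of_ne_zero
    (hdense : ∀ x : OrbitCoordRing f m,
      (∀ b : GL σ k, IsUpperTriangular b → evalAtPoint f m (orbitCoordRep f m (b * h₀)⁻¹ x) = 0) →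
        x = 0)
    {χ : Weight σ} {x : OrbitCoordRing f m} (hx : x ∈ highestWeightSpace (orbitCoordRep f m) χ)
    (hx0 : x ≠ 0) : evalAtPoint f m (orbitCoordRep f m h₀⁻¹ x) ≠ 0 :=
  fun h0 => hx0 (eq_zero_of_mem_highestWeightSpace_of_eval_eq_zero hdense hx h0)

/-- **Multiplicity-freeness at a Borel-dense point**: two highest-weight vectors of the same
weight are proportional — `y = (y(h₀·f) / x(h₀·f)) • x` for `x ≠ 0`. Vinberg–Kimel'fel'd 1978,
Thm. 1 (easy direction). [folklore] -/
theorem exists_smul_eq_of_mem_highestWeightSpace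
    (hdense : ∀ x : OrbitCoordRing f m,
      (∀ b : GL σ k, IsUpperTriangular b → evalAtPoint f m (orbitCoordRep f m (b * h₀)⁻¹ x) = 0) →
        x = 0)
    {χ : Weight σ} {x y : OrbitCoordRing f m} (hx : x ∈ highestWeightSpace (orbitCoordRep f m) χ)
    (hy : y ∈ highestWeightSpace (orbitCoordRep f m) χ) (hx0 : x ≠ 0) : ∃ c : k, y = c • x := by
  set a := evalAtPoint f m (orbitCoordRep f m h₀⁻¹ x) with ha
  set a' := evalAtPoint f m (orbitCoordRep f m h₀⁻¹ y) with ha'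
  have ha0 : a ≠ 0 := evalAtPoint_ne_zero_of_mem_highestWeightSpace_of_ne_zero hdense hx hx0
  refine ⟨a' / a, ?_⟩
  have hmem : y - (a' / a) • x ∈ highestWeightSpace (orbitCoordRep f m) χ :=
    Submodule.sub_mem _ hy (Submodule.smul_mem _ _ hx)
  have hz : y - (a' / a) • x = 0 := by
    refine eq_zero_of_mem_highestWeightSpace_of_eval_eq_zero hdense hmem ?_
    rw [map_sub, map_smul, map_sub, map_smul, smul_eq_mul, ← ha, ← ha', div_mul_cancel₀ a' ha0,
      sub_self]
  exact sub_eq_zero.mp hz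

/-- At a Borel-dense point every nonzero highest-weight vector spans its highest-weight space.
[folklore] -/
theorem highestWeightSpace_eq_span_of_dense
    (hdense : ∀ x : OrbitCoordRing f m,
      (∀ b : GL σ k, IsUpperTriangular b → evalAtPoint f m (orbitCoordRep f m (b * h₀)⁻¹ x) = 0) →
        x = 0)
    {χ : Weight σ} {x : OrbitCoordRing f m} (hx : x ∈ highestWeightSpace (orbitCoordRep f m) χ)
    (hx0 : x ≠ 0) : highestWeightSpace (orbitCoordRep f m) χ = k ∙ x := by
  refine le_antisymm (fun y hy => ?_) ((Submodule.span_singleton_le_iff_mem _ _).mpr hx)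
  obtain ⟨c, rfl⟩ := exists_smul_eq_of_mem_highestWeightSpace hdense hx hy hx0
  exact Submodule.smul_mem _ _ (Submodule.mem_span_singleton_self x)

/-- **The covariant algebra of a Borel-dense orbit closure is multiplicity-free**:
`dim HWV_χ(k[Δ_m f]) ≤ 1` for every weight `χ`. Vinberg–Kimel'fel'd 1978, Thm. 1 (easy
direction). [folklore] -/
theorem finrank_highestWeightSpace_le_one_of_dense
    (hdense : ∀ x : OrbitCoordRing f m,
      (∀ b : GL σ k, IsUpperTriangular b → evalAtPoint f m (orbitCoordRep f m (b * h₀)⁻¹ x) = 0) →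
        x = 0)
    (χ : Weight σ) : Module.finrank k (highestWeightSpace (orbitCoordRep f m) χ) ≤ 1 := by
  by_cases hbot : highestWeightSpace (orbitCoordRep f m) χ = ⊥
  · rw [hbot, finrank_bot]
    exact zero_le_one
  · obtain ⟨x, hx, hx0⟩ := (Submodule.ne_bot_iff _).mp hbot
    rw [highestWeightSpace_eq_span_of_dense hdense hx hx0]
    exact (finrank_span_le_card ({x} : Set (OrbitCoordRing f m))).trans
      (by rw [Set.toFinset_card, Set.card_singleton])

/-- **Stabiliser constraint on occurring weights**: if an upper triangular `b` FIXES the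
Borel-dense point, `(b h₀) · f = h₀ · f`, then `χ(b) = 1` for every weight `χ` occurring in
`k[Δ_m f]` (`x(h₀ · f) = x((b h₀) · f) = χ(b)⁻¹ x(h₀ · f)` with `x(h₀ · f) ≠ 0`). Vinberg–Kimel'fel'd
1978 (the weight monoid of `G/H` lies in the characters trivial on `B ∩ H`). [folklore] -/
theorem weightChar_eq_one_of_fix_of_dense
    (hdense : ∀ x : OrbitCoordRing f m,
      (∀ b : GL σ k, IsUpperTriangular b → evalAtPoint f m (orbitCoordRep f m (b * h₀)⁻¹ x) = 0) →
        x = 0)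
    {b : GL σ k} (hb : IsUpperTriangular b)
    (hfix : linSubstRep σ k (b * h₀) f = linSubstRep σ k h₀ f) {χ : Weight σ}
    (hχ : highestWeightSpace (orbitCoordRep f m) χ ≠ ⊥) : weightChar χ b = 1 := by
  obtain ⟨x, hx, hx0⟩ := (Submodule.ne_bot_iff _).mp hχ
  have ha0 := evalAtPoint_ne_zero_of_mem_highestWeightSpace_of_ne_zero hdense hx hx0
  have h1 := evalAtPoint_orbitCoordRep_mul_inv_of_mem_highestWeightSpace hx hb h₀
  rw [evalAtPoint_orbitCoordRep_inv_congr f m hfix x] at h1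
  have h2 : (weightChar χ b)⁻¹ = 1 := by
    have := h1.symm
    rwa [mul_left_eq_self₀, or_iff_left ha0] at this
  exact inv_eq_one.mp h2

/-! ## 3. Generator types are atoms of the occurrence monoid -/

/-- **A splitting into two occurring weights fills the highest-weight space by products.** At a
Borel-dense point, if `χ₁`, `χ₂` both occur in `k[Δ_m f]` (infinite field) then the decomposable
part `Σ_{ψ₁+ψ₂=χ₁+χ₂, ψᵢ≠0} HWV_ψ₁ · HWV_ψ₂` contains ALL of `HWV_{χ₁+χ₂}` as soon as
`χ₁, χ₂ ≠ 0`: the product of two nonzero highest-weight vectors is a nonzero (domain,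
`isDomain_orbitCoordRing`) highest-weight vector of weight `χ₁ + χ₂`
(`mul_mem_highestWeightSpace_orbitCoordRep`) and spans that line. [folklore] -/
theorem comap_decomposable_eq_top_of_dense [Infinite k]
    (hdense : ∀ x : OrbitCoordRing f m,
      (∀ b : GL σ k, IsUpperTriangular b → evalAtPoint f m (orbitCoordRep f m (b * h₀)⁻¹ x) = 0) →
        x = 0)
    {χ χ₁ χ₂ : Weight σ} (hsum : χ₁ + χ₂ = χ) (h1 : χ₁ ≠ 0) (h2 : χ₂ ≠ 0)
    (hne1 : highestWeightSpace (orbitCoordRep f m) χ₁ ≠ ⊥)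
    (hne2 : highestWeightSpace (orbitCoordRep f m) χ₂ ≠ ⊥) :
    Submodule.comap (highestWeightSpace (orbitCoordRep f m) χ).subtype
        (⨆ p : Weight σ × Weight σ, ⨆ (_ : p.1 + p.2 = χ ∧ p.1 ≠ 0 ∧ p.2 ≠ 0),
          highestWeightSpace (orbitCoordRep f m) p.1 * highestWeightSpace (orbitCoordRep f m) p.2) =
      ⊤ := by
  haveI := isDomain_orbitCoordRing f m
  obtain ⟨x₁, hx₁, hx₁0⟩ := (Submodule.ne_bot_iff _).mp hne1
  obtain ⟨x₂, hx₂, hx₂0⟩ := (Submodule.ne_bot_iff _).mp hne2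
  have hprod : x₁ * x₂ ∈ highestWeightSpace (orbitCoordRep f m) χ := by
    rw [← hsum]
    exact Literature.Computability.Complexity.mul_mem_highestWeightSpace_orbitCoordRep f m hx₁ hx₂
  have hprod0 : x₁ * x₂ ≠ 0 := mul_ne_zero hx₁0 hx₂0
  have hspan := highestWeightSpace_eq_span_of_dense hdense hprod hprod0
  rw [Submodule.comap_subtype_eq_top, hspan, Submodule.span_singleton_le_iff_mem]
  refine Submodule.mem_iSup_of_mem (χ₁, χ₂) (Submodule.mem_iSup_of_mem ⟨hsum, h1, h2⟩ ?_)
  exact Submodule.mul_mem_mul hx₁ hx₂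

/-- **A split occurring weight is not a generator type** (Borel-dense orbit closures):
`γ_{χ₁+χ₂}(f) = 0` whenever `χ₁, χ₂ ≠ 0` both occur. [folklore] -/
theorem finrank_quotient_eq_zero_of_split_of_dense [Infinite k]
    (hdense : ∀ x : OrbitCoordRing f m,
      (∀ b : GL σ k, IsUpperTriangular b → evalAtPoint f m (orbitCoordRep f m (b * h₀)⁻¹ x) = 0) →
        x = 0)
    {χ χ₁ χ₂ : Weight σ} (hsum : χ₁ + χ₂ = χ) (h1 : χ₁ ≠ 0) (h2 : χ₂ ≠ 0)
    (hne1 : highestWeightSpace (orbitCoordRep f m) χ₁ ≠ ⊥)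
    (hne2 : highestWeightSpace (orbitCoordRep f m) χ₂ ≠ ⊥) :
    Module.finrank k (↥(highestWeightSpace (orbitCoordRep f m) χ) ⧸
      Submodule.comap (highestWeightSpace (orbitCoordRep f m) χ).subtype
        (⨆ p : Weight σ × Weight σ, ⨆ (_ : p.1 + p.2 = χ ∧ p.1 ≠ 0 ∧ p.2 ≠ 0),
          highestWeightSpace (orbitCoordRep f m) p.1 * highestWeightSpace (orbitCoordRep f m) p.2)) =
      0 := by
  have htop := comap_decomposable_eq_top_of_dense hdense hsum h1 h2 hne1 hne2
  haveI : Subsingleton (↥(highestWeightSpace (orbitCoordRep f m) χ) ⧸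
      Submodule.comap (highestWeightSpace (orbitCoordRep f m) χ).subtype
        (⨆ p : Weight σ × Weight σ, ⨆ (_ : p.1 + p.2 = χ ∧ p.1 ≠ 0 ∧ p.2 ≠ 0),
          highestWeightSpace (orbitCoordRep f m) p.1 * highestWeightSpace (orbitCoordRep f m) p.2)) :=
    Submodule.Quotient.subsingleton_iff.mpr htop
  exact Module.finrank_zero_of_subsingleton

/-- **Generator types of a Borel-dense orbit closure are atoms of its occurrence monoid**: if
`γ_χ(f) ≠ 0` then `χ` admits no splitting `χ = χ₁ + χ₂` into two nonzero occurring weights (the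
atom clause of the registered stubs, verbatim). Together with the landed converse
(`finrank_quotient_ne_zero_of_atom`: atoms are generator types, any `f`) the minimal generators of
the covariant algebra of a spherical orbit closure are read off from occurrence data alone.
Vinberg–Kimel'fel'd 1978, Thm. 1; Popov 1987 §1. [folklore] -/
theorem atom_of_genType_of_dense [Infinite k]
    (hdense : ∀ x : OrbitCoordRing f m,
      (∀ b : GL σ k, IsUpperTriangular b → evalAtPoint f m (orbitCoordRep f m (b * h₀)⁻¹ x) = 0) →
        x = 0)
    {χ : Weight σ}
    (hγ : Module.finrank k (↥(highestWeightSpace (orbitCoordRep f m) χ) ⧸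
      Submodule.comap (highestWeightSpace (orbitCoordRep f m) χ).subtype
        (⨆ p : Weight σ × Weight σ, ⨆ (_ : p.1 + p.2 = χ ∧ p.1 ≠ 0 ∧ p.2 ≠ 0),
          highestWeightSpace (orbitCoordRep f m) p.1 * highestWeightSpace (orbitCoordRep f m) p.2)) ≠
      0) :
    ∀ χ₁ χ₂ : Weight σ, χ₁ + χ₂ = χ → χ₁ ≠ 0 → χ₂ ≠ 0 →
      highestWeightSpace (orbitCoordRep f m) χ₁ = ⊥ ∨ highestWeightSpace (orbitCoordRep f m) χ₂ = ⊥ := by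
  intro χ₁ χ₂ hsum h1 h2
  by_contra hne
  rw [not_or] at hne
  exact hγ (finrank_quotient_eq_zero_of_split_of_dense hdense hsum h1 h2 hne.1 hne.2)

end Dense

end

end Summit.ValiantsHypothesis.ValiantsHypothesis.Theorems.GeneratorObstructions.PowGenDegreeQP
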